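import Mathlib
import HarnessLib
import Literature.Probability.Percolation.CornerPercolation
import Literature.Analysis.Complex.VitaliConvergence
import Literature.Barriers.CriticalPhenomena.EmbeddingModulusUniquenessProofs
import Literature.Probability.RandomPlanarGeometry.ConformalRectangleProofs
import Literature.Probability.Percolation.QuadCrossingSquareModel
import Summits.CriticalPhenomena.CardyFormulaZ2.Theorems.SegmentOpen.Negative.NormOne
import Literature.Probability.RandomPlanarGeometry.RectangleModulusLambda
import Literature.Probability.RandomPlanarGeometry.ImageUnivalent
import Literature.Probability.RandomPlanarGeometry.CardyFunctionIncBeta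
import Literature.Probability.RandomPlanarGeometry.SLESixCrossingNondegenerate
import Summits.CriticalPhenomena.CardyFormulaZ2.Theorems.CardySelfDualSegmentSegmentOpenStubVitaliTransfer
import Literature.Probability.RandomPlanarGeometry.DiamondShearChart

/-!
# Crux `SegmentOpen` (stmt-CriticalPhenomena-5471), line `Sketch` — stub `stub_accumulationInteriorGood`

The theorem name, namespace, `open` lines and statement are those registered by the lead's
skeleton (`work/SegmentOpen.lean`, `Cruxes/SegmentOpen/Lines/Sketch.lean`).  ACCUMULATION ⇒
INTERIOR at good points of `G = {t | ∃ α ∈ ℍ, CardyMod t α}`, given the Ahlfors–Bers analyticity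
of the moduli `α ↦ η(φ_α R')` (hypothesis 1) and uniform-radius Vitali transfer (hypothesis 2):

0. `AccPt` gives good points `u n → t₀`, `u n ≠ t₀` (`exists_seq_of_accPt`); their moduli `α n`
   and the modulus `α₀` of `t₀` lie on the unit circle
   (`SegmentOpen.Negative.norm_eq_one_of_cardyMod`), so `α = (1 + is)²/(1 + s²)` with `s > 0`
   (`exists_circleParam_of_norm_eq_one`).
1. Cardy limits exist at every `u n` for every `R` (test `CardyMod (u n) (α n)` on the sheared
   presentation `R.map (shearHomeomorph (α n))`, `exists_shear_presentation`), so hypothesis 2 with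
   the ONE radius `r` of the UA hypothesis gives real-analytic limit functions `g R` on `B(t₀, r)`;
   by uniqueness of limits `g R' (u n) = F(M_{R'}(α n))` and, for the diamond test quad `D` of
   `Literature.Probability.RandomPlanarGeometry.exists_diamond_shear_chart`,
   `g D (u n) = F(λ(i s n)) = c (s n)` with the chart function `c s = F(λ(is))`.
2.–4. `core_chart`: `c` is strictly decreasing (`strictAntiOn_cardyFunction_lamR`), so
   `s n → s₀`; `c` is analytic with `c' ≠ 0` (`analyticAt_cardyFunction_lamR`,
   `deriv_cardyFunction_lamR_ne_zero`), so its analytic local inverse `L`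
   (`AnalyticAt.analyticAt_localInverse`) makes `S = L ∘ g D` analytic near `t₀` with
   `S (u n) = s n` eventually; the identity theorem for real-analytic functions on a ball
   (`AnalyticOnNhd.eqOn_of_preconnected_of_frequently_eq`) identifies `g R'` with
   `F ∘ M_{R'} ∘ α ∘ S` for EVERY `R'` on one ball `B(t₀, r₀)`.
5.–6. Every `t` of that ball is good with modulus `α(S t)`, so `B(t₀, r₀) ⊆ G` and
   `t₀ ∈ interior G`.
-/
noncomputable section

namespace Summit.CriticalPhenomena.CardyFormulaZ2.Theorems

open Literature.Probability Literature.Barriers.CriticalPhenomena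
open Literature.Probability.RandomPlanarGeometry (ConformalRectangle ConformalEquiv MarkedDomain)
open Filter Set Topology

/-! ### Helpers: sequences, strictly antitone charts, local analytic inverses -/

section Helpers

open Literature.Probability.RandomPlanarGeometry

/-- An accumulation point of a set in a Fréchet–Urysohn space is the limit of a sequence of
points of the set distinct from it. -/
private theorem exists_seq_of_accPt {X : Type*} [TopologicalSpace X] [FrechetUrysohnSpace X]
    {G : Set X} {t₀ : X} (h : AccPt t₀ (𝓟 G)) :
    ∃ u : ℕ → X, Tendsto u atTop (𝓝 t₀) ∧ (∀ n, u n ≠ t₀) ∧ ∀ n, u n ∈ G := by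
  have hcl : t₀ ∈ closure (G \ {t₀}) :=
    mem_closure_iff_nhdsWithin_neBot.2 (accPt_principal_iff_nhdsWithin.1 h)
  obtain ⟨u, hu, hlim⟩ := mem_closure_iff_seq_limit.1 hcl
  exact ⟨u, hlim, fun n => (hu n).2, fun n => (hu n).1⟩

/-- If `c` is strictly decreasing on `(0, ∞)` and `c (s n) → c s₀` with all `s n, s₀ > 0`, then
`s n → s₀` (no continuity needed: order-separate `s₀` by `c`). -/
private theorem tendsto_of_tendsto_comp_strictAntiOn {c : ℝ → ℝ} (hc : StrictAntiOn c (Ioi 0))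
    {s : ℕ → ℝ} (hs : ∀ n, 0 < s n) {s₀ : ℝ} (hs₀ : 0 < s₀)
    (h : Tendsto (fun n => c (s n)) atTop (𝓝 (c s₀))) : Tendsto s atTop (𝓝 s₀) := by
  rw [tendsto_order]
  obtain ⟨hlo, hhi⟩ := tendsto_order.1 h
  constructor
  · intro a ha
    rcases le_or_gt a 0 with ha0 | ha0
    · exact Eventually.of_forall fun n => ha0.trans_lt (hs n)
    · have hca : c s₀ < c a := hc ha0 hs₀ ha
      filter_upwards [hhi _ hca] with n hn
      by_contra hle
      exact (hc.antitoneOn (hs n) ha0 (not_lt.1 hle)).not_gt hn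
  · intro b hb
    have hb0 : (0 : ℝ) < b := hs₀.trans hb
    have hcb : c b < c s₀ := hc hs₀ hb0 hb
    filter_upwards [hlo _ hcb] with n hn
    by_contra hle
    exact (hc.antitoneOn hb0 (hs n) (not_lt.1 hle)).not_gt hn

/-- **Local analytic inverse over `ℝ`.** An analytic germ `c` at `a` with `c′(a) ≠ 0` has a local
inverse `L`, analytic at `c a`, with `L (c a) = a` and `L (c t) = t` near `a` (Mathlib's
`AnalyticAt.analyticAt_localInverse`). -/
private theorem exists_local_inverse_real {c : ℝ → ℝ} {a : ℝ} (hσ : AnalyticAt ℝ c a)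
    (hσ' : deriv c a ≠ 0) :
    ∃ L : ℝ → ℝ, AnalyticAt ℝ L (c a) ∧ L (c a) = a ∧ ∀ᶠ t in 𝓝 a, L (c t) = t :=
  -- adapted from `Literature.Analysis.Complex.LocalUniformizer.exists_local_inverse`
  ⟨hσ.hasStrictDerivAt.localInverse c (deriv c a) a hσ', hσ.analyticAt_localInverse hσ',
    HasStrictFDerivAt.localInverse_apply_image .., HasStrictDerivAt.eventually_left_inverse ..⟩

/-- Every conformal rectangle `R'` has a presentation of its shear `φ_α R'` (`α ∉ ℝ`) with a
uniformizing datum: `R'.map (shearHomeomorph α)` and `MarkedDomain.exists_isUniformizing_holds`. -/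
private theorem exists_shear_presentation (R' : ConformalRectangle) {α : ℂ} (hα : α.im ≠ 0) :
    ∃ (R : ConformalRectangle) (φ : ConformalEquiv UpperHalfPlane.upperHalfPlaneSet R.carrier)
      (x : Fin 4 → ℝ), R.carrier = moduliShear α '' R'.carrier ∧
      (∀ i, R.pt i = moduliShear α (R'.pt i)) ∧ R.IsUniformizing φ x := by
  obtain ⟨φ, x, hφ⟩ :=
    MarkedDomain.exists_isUniformizing_holds (R'.map (shearHomeomorph α hα))
  exact ⟨_, φ, x, by rw [MarkedDomain.carrier_map, coe_shearHomeomorph],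
    fun i => by rw [MarkedDomain.pt_map, coe_shearHomeomorph], hφ⟩

/-- **The analytic core of the accumulation step.** Data: a strictly decreasing real-analytic
chart `c` on `(0, ∞)` with non-vanishing derivative; limit functions `g R`, real-analytic on ONE
ball `B(t₀, r)`; a sequence `u n → t₀`, `u n ≠ t₀`, with parameters `s n > 0` such that
`g D (u n) = c (s n)` eventually and `g D t₀ = c s₀` (`s₀ > 0`) for a test quad `D`; modulus
functions `M R'`, real-analytic on the upper half-plane with values in `(0, 1)`, such that
`g R' (u n) = F (M R' (α(s n)))` eventually, `α(s) = (1 + is)²/(1 + s²)`.  Conclusion: on a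
smaller ball `B(t₀, r₀)` there is a positive function `S` with `g R' = F ∘ M R' ∘ α ∘ S` for
EVERY `R'`.  Proof: `s n → s₀` (strict antitonicity of `c`), `S = L ∘ g D` with `L` the analytic
local inverse of `c` at `s₀` (so `S` is analytic near `t₀`, `S (u n) = s n` eventually), and the
identity theorem for real-analytic functions on the ball. -/
private theorem core_chart {c : ℝ → ℝ} (hc_anti : StrictAntiOn c (Ioi 0))
    (hc_an : ∀ s, 0 < s → AnalyticAt ℝ c s) (hc_der : ∀ s, 0 < s → deriv c s ≠ 0)
    {t₀ r : ℝ} (hr : 0 < r) {g : ConformalRectangle → ℝ → ℝ}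
    (hga : ∀ R, AnalyticOnNhd ℝ (g R) (Metric.ball t₀ r))
    {u : ℕ → ℝ} (hu : Tendsto u atTop (𝓝 t₀)) (hne : ∀ n, u n ≠ t₀)
    {s : ℕ → ℝ} (hs : ∀ n, 0 < s n) {s₀ : ℝ} (hs₀ : 0 < s₀)
    {D : ConformalRectangle} (hD : ∀ᶠ n in atTop, g D (u n) = c (s n)) (hD₀ : g D t₀ = c s₀)
    {M : ConformalRectangle → ℂ → ℝ} (hMa : ∀ R', AnalyticOnNhd ℝ (M R') {α : ℂ | 0 < α.im})
    (hM01 : ∀ R' (α : ℂ), 0 < α.im → M R' α ∈ Ioo (0 : ℝ) 1)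
    (hgM : ∀ R', ∀ᶠ n in atTop,
      g R' (u n) = cardyFunction (M R' ((1 + (s n : ℂ) * Complex.I) ^ 2 / (1 + (s n : ℂ) ^ 2)))) :
    ∃ r₀, 0 < r₀ ∧ r₀ ≤ r ∧ ∃ S : ℝ → ℝ, (∀ t ∈ Metric.ball t₀ r₀, 0 < S t) ∧
      ∀ R', EqOn (g R')
        (fun t => cardyFunction (M R' ((1 + (S t : ℂ) * Complex.I) ^ 2 / (1 + (S t : ℂ) ^ 2))))
        (Metric.ball t₀ r₀) := by
  -- `s n → s₀`
  have hgDc : Tendsto (fun n => g D (u n)) atTop (𝓝 (g D t₀)) :=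
    ((hga D t₀ (Metric.mem_ball_self hr)).continuousAt.tendsto).comp hu
  have hcs : Tendsto (fun n => c (s n)) atTop (𝓝 (c s₀)) := by
    rw [← hD₀]
    exact hgDc.congr' hD
  have hss : Tendsto s atTop (𝓝 s₀) := tendsto_of_tendsto_comp_strictAntiOn hc_anti hs hs₀ hcs
  -- the local inverse and `S = L ∘ g D`
  obtain ⟨L, hLa, hL₀, hLc⟩ := exists_local_inverse_real (hc_an s₀ hs₀) (hc_der s₀ hs₀)
  set S : ℝ → ℝ := fun t => L (g D t) with hSdef
  have hS₀ : S t₀ = s₀ := by rw [hSdef]; dsimp only; rw [hD₀, hL₀]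
  have hSa : AnalyticAt ℝ S t₀ :=
    hLa.comp_of_eq (hga D t₀ (Metric.mem_ball_self hr)) hD₀
  have hSu : ∀ᶠ n in atTop, S (u n) = s n := by
    filter_upwards [hD, hss.eventually hLc] with n hn hn'
    rw [hSdef]; dsimp only; rw [hn, hn']
  -- a ball where `S` is analytic and positive
  have hev : ∀ᶠ t in 𝓝 t₀, AnalyticAt ℝ S t ∧ 0 < S t := by
    refine hSa.eventually_analyticAt.and ?_
    have : ∀ᶠ t in 𝓝 t₀, s₀ / 2 < S t :=
      hSa.continuousAt.tendsto.eventually (lt_mem_nhds (by rw [hS₀]; linarith))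
    exact this.mono fun t ht => by linarith
  obtain ⟨ε, hε, hball⟩ := Metric.eventually_nhds_iff_ball.1 hev
  refine ⟨min ε r, lt_min hε hr, min_le_right _ _, S,
    fun t ht => (hball t (Metric.ball_subset_ball (min_le_left _ _) ht)).2, fun R' => ?_⟩
  have hsub : Metric.ball t₀ (min ε r) ⊆ Metric.ball t₀ ε :=
    Metric.ball_subset_ball (min_le_left _ _)
  -- the comparison function is analytic on the small ball
  have hH : AnalyticOnNhd ℝ
      (fun t => cardyFunction (M R' ((1 + (S t : ℂ) * Complex.I) ^ 2 / (1 + (S t : ℂ) ^ 2))))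
      (Metric.ball t₀ (min ε r)) := by
    intro t ht
    obtain ⟨hSt, hSpos⟩ := hball t (hsub ht)
    have h1 : AnalyticAt ℝ (fun t => (1 + (S t : ℂ) * Complex.I) ^ 2 / (1 + (S t : ℂ) ^ 2)) t :=
      (analyticAt_circleParam (S t)).comp_of_eq hSt rfl
    have him := circleParam_im_pos hSpos
    have h2 : AnalyticAt ℝ
        (fun t => M R' ((1 + (S t : ℂ) * Complex.I) ^ 2 / (1 + (S t : ℂ) ^ 2))) t :=
      (hMa R' _ him).comp_of_eq h1 rfl
    exact (analyticOnNhd_cardyFunction_Ioo _ (hM01 R' _ him)).comp_of_eq h2 rfl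
  -- the two functions agree along `u n`
  have hfreq : ∃ᶠ t in 𝓝[≠] t₀,
      g R' t = cardyFunction (M R' ((1 + (S t : ℂ) * Complex.I) ^ 2 / (1 + (S t : ℂ) ^ 2))) := by
    have hu' : Tendsto u atTop (𝓝[≠] t₀) :=
      tendsto_nhdsWithin_iff.2 ⟨hu, Eventually.of_forall fun n => hne n⟩
    refine hu'.frequently ?_
    refine Eventually.frequently ?_
    filter_upwards [hgM R', hSu] with n hn hn'
    rw [hn, hn']
  exact ((hga R').mono
    (Metric.ball_subset_ball (min_le_right _ _))).eqOn_of_preconnected_of_frequently_eq hH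
    (convex_ball t₀ _).isPreconnected (Metric.mem_ball_self (lt_min hε hr)) hfreq

end Helpers

/-- S5' (L; reshape of S5 after the wave-2 analysis `S5-analysis.md`: restricted to GOOD accumulation
points — the only way the composition uses it — so that confinement (moduli of degenerating
sheared boxes), the RSW bound and UM all drop out, and the single classical input is the
Ahlfors–Bers fact S7, taken as the first hypothesis). ACCUMULATION ⇒ INTERIOR at good points:
if `t₀ ∈ G` is an accumulation point of `G` and weak uniform analyticity holds at `t₀` (one
complex radius for all `R`), then `t₀` is an interior point of `G`. Proof plan (S5-analysis.md §4):
good moduli lie on the unit circle (`SegmentOpen.Negative.norm_eq_one_of_cardyMod`), the diamond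
test quad charts them (`rectangle_crossRatio_eq_lamR`, `hasDerivAt_lamR`,
`hasDerivAt_cardyFunction_holds`: `s ↦ F(λ(is))` has nonvanishing derivative), uniform-radius
Vitali (S2') gives real-analytic limits `g_R` on ONE ball, the analytic local inverse
(`AnalyticAt.analyticAt_localInverse`) makes `s(t)` analytic, and the identity theorem over `ℝ`
identifies `g_R` with `F(M_R(α(s(t))))` for every `R`. -/
theorem stub_accumulationInteriorGood :
    (∀ R' : ConformalRectangle, ∃ M : ℂ → ℝ, AnalyticOnNhd ℝ M {α : ℂ | 0 < α.im} ∧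
      ∀ α : ℂ, 0 < α.im → ∀ (R : ConformalRectangle)
        (φ : ConformalEquiv UpperHalfPlane.upperHalfPlaneSet R.carrier) (x : Fin 4 → ℝ),
        R.carrier = moduliShear α '' R'.carrier → (∀ i, R.pt i = moduliShear α (R'.pt i)) →
        R.IsUniformizing φ x → RandomPlanarGeometry.crossRatio x = M α) →
    (∀ (t₀ : unitInterval) (R : ConformalRectangle) (r : ℝ), 0 < r →
      (∃ C : ℝ, ∀ δ : ℝ, 0 < δ →
        ∃ f : ℂ → ℂ, DifferentiableOn ℂ f (Metric.ball ((t₀ : ℝ) : ℂ) r) ∧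
          (∀ z ∈ Metric.ball ((t₀ : ℝ) : ℂ) r, ‖f z‖ ≤ C) ∧
          ∀ t : unitInterval, dist t t₀ < r →
            f ((t : ℝ) : ℂ) = Percolation.cornerCrossingProb t R δ) →
      (∃ u : ℕ → unitInterval, Tendsto u atTop (𝓝 t₀) ∧ (∀ n, u n ≠ t₀) ∧
        ∀ n, ∃ L : ℝ, Tendsto (Percolation.cornerCrossingProb (u n) R) (𝓝[>] 0) (𝓝 L)) →
      ∃ g : ℝ → ℝ, AnalyticOnNhd ℝ g (Metric.ball (t₀ : ℝ) r) ∧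
        ∀ t : unitInterval, dist t t₀ < r →
          Tendsto (Percolation.cornerCrossingProb t R) (𝓝[>] 0) (𝓝 (g t))) →
    ∀ t₀ : unitInterval,
      (∃ r > 0, ∀ R : ConformalRectangle, ∃ C : ℝ, ∀ δ : ℝ, 0 < δ →
        ∃ f : ℂ → ℂ, DifferentiableOn ℂ f (Metric.ball ((t₀ : ℝ) : ℂ) r) ∧
          (∀ z ∈ Metric.ball ((t₀ : ℝ) : ℂ) r, ‖f z‖ ≤ C) ∧
          ∀ t : unitInterval, dist t t₀ < r →
            f ((t : ℝ) : ℂ) = Percolation.cornerCrossingProb t R δ) →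
      t₀ ∈ {t : unitInterval | ∃ α : ℂ, 0 < α.im ∧
        ∀ (R R' : ConformalRectangle)
          (φ : ConformalEquiv UpperHalfPlane.upperHalfPlaneSet R.carrier) (x : Fin 4 → ℝ),
          R.carrier = moduliShear α '' R'.carrier → (∀ i, R.pt i = moduliShear α (R'.pt i)) →
          R.IsUniformizing φ x →
          Tendsto (Percolation.cornerCrossingProb t R') (𝓝[>] 0)
            (𝓝 (RandomPlanarGeometry.cardyFunction (RandomPlanarGeometry.crossRatio x)))} →
      AccPt t₀ (𝓟 {t : unitInterval | ∃ α : ℂ, 0 < α.im ∧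
        ∀ (R R' : ConformalRectangle)
          (φ : ConformalEquiv UpperHalfPlane.upperHalfPlaneSet R.carrier) (x : Fin 4 → ℝ),
          R.carrier = moduliShear α '' R'.carrier → (∀ i, R.pt i = moduliShear α (R'.pt i)) →
          R.IsUniformizing φ x →
          Tendsto (Percolation.cornerCrossingProb t R') (𝓝[>] 0)
            (𝓝 (RandomPlanarGeometry.cardyFunction (RandomPlanarGeometry.crossRatio x)))}) →
      t₀ ∈ interior {t : unitInterval | ∃ α : ℂ, 0 < α.im ∧
        ∀ (R R' : ConformalRectangle)
          (φ : ConformalEquiv UpperHalfPlane.upperHalfPlaneSet R.carrier) (x : Fin 4 → ℝ),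
          R.carrier = moduliShear α '' R'.carrier → (∀ i, R.pt i = moduliShear α (R'.pt i)) →
          R.IsUniformizing φ x →
          Tendsto (Percolation.cornerCrossingProb t R') (𝓝[>] 0)
            (𝓝 (RandomPlanarGeometry.cardyFunction (RandomPlanarGeometry.crossRatio x)))} := by
  intro hAB hVit t₀ hUA ht₀ hacc
  -- Step 0: good points `u n → t₀`, `u n ≠ t₀`, with moduli `α n`; the modulus `α₀` of `t₀`
  obtain ⟨u, hu, hune, huG⟩ := exists_seq_of_accPt hacc
  choose α hαim hαC using huG
  obtain ⟨α₀, hα₀im, hα₀C⟩ := ht₀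
  -- good moduli lie on the unit circle: `α = (1 + is)²/(1 + s²)`, `s > 0`
  have hnorm : ∀ n, ‖α n‖ = 1 := fun n =>
    SegmentOpen.Negative.norm_eq_one_of_cardyMod (u n) (hαim n) (hαC n)
  have hnorm₀ : ‖α₀‖ = 1 := SegmentOpen.Negative.norm_eq_one_of_cardyMod t₀ hα₀im hα₀C
  choose sq hsq hαsq using fun n =>
    RandomPlanarGeometry.exists_circleParam_of_norm_eq_one (hnorm n) (hαim n)
  obtain ⟨s₀, hs₀, hα₀s⟩ := RandomPlanarGeometry.exists_circleParam_of_norm_eq_one hnorm₀ hα₀im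
  -- Step 1: Vitali limits `g R` on the ONE ball of the UA hypothesis
  obtain ⟨r, hr, hUA⟩ := hUA
  have hlimex : ∀ (R : ConformalRectangle) (n : ℕ),
      ∃ L : ℝ, Tendsto (Percolation.cornerCrossingProb (u n) R) (𝓝[>] 0) (𝓝 L) := fun R n => by
    obtain ⟨Q, φ, x, hc, hp, hφ⟩ := exists_shear_presentation R (hαim n).ne'
    exact ⟨_, hαC n Q R φ x hc hp hφ⟩
  choose g hga hgl using fun R => hVit t₀ R r hr (hUA R) ⟨u, hu, hune, hlimex R⟩
  -- the modulus functions of the Ahlfors–Bers hypothesis, with values in `(0, 1)`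
  choose M hMa hM using hAB
  have hM01 : ∀ (R' : ConformalRectangle) (β : ℂ), 0 < β.im → M R' β ∈ Ioo (0 : ℝ) 1 :=
    fun R' β hβ => by
      obtain ⟨Q, φ, x, hc, hp, hφ⟩ := exists_shear_presentation R' hβ.ne'
      rw [← hM R' β hβ Q φ x hc hp hφ]
      exact ConformalRectangle.crossRatio_mem_Ioo_of_isUniformizing hφ
  -- the diamond test quad and its chart `c s = F(λ(is))`
  obtain ⟨D, hD⟩ := RandomPlanarGeometry.exists_diamond_shear_chart
  set c : ℝ → ℝ := fun s =>
    RandomPlanarGeometry.cardyFunction (RandomPlanarGeometry.KlebanZagier.lamR s) with hcdef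
  -- identification of the Vitali limits along `u n` and at `t₀`
  have hev : ∀ᶠ n in atTop, dist (u n) t₀ < r := Metric.tendsto_nhds.1 hu r hr
  have hgD : ∀ᶠ n in atTop, g D (u n) = c (sq n) := hev.mono fun n hn => by
    obtain ⟨Q, φ, x, hc, hp, hφ⟩ := exists_shear_presentation D (hαim n).ne'
    rw [tendsto_nhds_unique (hgl D (u n) hn) (hαC n Q D φ x hc hp hφ), hcdef]
    dsimp only
    rw [hD (sq n) (hsq n) Q φ x (by rw [hc, hαsq]) (fun i => by rw [hp i, hαsq n]) hφ]
  have hgD₀ : g D t₀ = c s₀ := by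
    obtain ⟨Q, φ, x, hc, hp, hφ⟩ := exists_shear_presentation D hα₀im.ne'
    rw [tendsto_nhds_unique (hgl D t₀ (by rw [dist_self]; exact hr)) (hα₀C Q D φ x hc hp hφ), hcdef]
    dsimp only
    rw [hD s₀ hs₀ Q φ x (by rw [hc, hα₀s]) (fun i => by rw [hp i, hα₀s]) hφ]
  have hgM : ∀ R' : ConformalRectangle, ∀ᶠ n in atTop, g R' (u n) =
      RandomPlanarGeometry.cardyFunction
        (M R' ((1 + (sq n : ℂ) * Complex.I) ^ 2 / (1 + (sq n : ℂ) ^ 2))) :=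
    fun R' => hev.mono fun n hn => by
      obtain ⟨Q, φ, x, hc, hp, hφ⟩ := exists_shear_presentation R' (hαim n).ne'
      rw [tendsto_nhds_unique (hgl R' (u n) hn) (hαC n Q R' φ x hc hp hφ),
        hM R' (α n) (hαim n) Q φ x hc hp hφ, hαsq n]
  -- Steps 2–4: the analytic core (chart, local inverse, identity theorem)
  have hu' : Tendsto (fun n => ((u n : unitInterval) : ℝ)) atTop (𝓝 (t₀ : ℝ)) :=
    (continuous_subtype_val.tendsto t₀).comp hu
  have hne' : ∀ n, ((u n : unitInterval) : ℝ) ≠ (t₀ : ℝ) := fun n h =>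
    hune n (Subtype.ext h)
  obtain ⟨r₀, hr₀, hr₀r, S, hSpos, hEq⟩ := core_chart
    RandomPlanarGeometry.strictAntiOn_cardyFunction_lamR
    (fun s hs => RandomPlanarGeometry.analyticAt_cardyFunction_lamR hs)
    (fun s hs => RandomPlanarGeometry.deriv_cardyFunction_lamR_ne_zero hs)
    hr hga hu' hne' hsq hs₀ hgD hgD₀ hMa hM01 hgM
  -- Step 5: every parameter of the small ball is good, with modulus `α(S t)`
  have hgood : ∀ t : unitInterval, dist t t₀ < r₀ → ∃ β : ℂ, 0 < β.im ∧
      ∀ (R R' : ConformalRectangle)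
        (φ : ConformalEquiv UpperHalfPlane.upperHalfPlaneSet R.carrier) (x : Fin 4 → ℝ),
        R.carrier = moduliShear β '' R'.carrier → (∀ i, R.pt i = moduliShear β (R'.pt i)) →
        R.IsUniformizing φ x →
        Tendsto (Percolation.cornerCrossingProb t R') (𝓝[>] 0)
          (𝓝 (RandomPlanarGeometry.cardyFunction (RandomPlanarGeometry.crossRatio x))) := by
    intro t ht
    have ht' : (t : ℝ) ∈ Metric.ball (t₀ : ℝ) r₀ := by
      rw [Metric.mem_ball, ← Subtype.dist_eq]; exact ht
    have him := RandomPlanarGeometry.circleParam_im_pos (hSpos _ ht')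
    refine ⟨_, him, fun R R' φ x hc hp hφ => ?_⟩
    have h2 : g R' (t : ℝ) =
        RandomPlanarGeometry.cardyFunction (RandomPlanarGeometry.crossRatio x) := by
      rw [hM R' _ him R φ x hc hp hφ]
      exact hEq R' ht'
    rw [← h2]
    exact hgl R' t (ht.trans_le hr₀r)
  -- Step 6: interior
  exact mem_interior_iff_mem_nhds.2
    (mem_of_superset (Metric.ball_mem_nhds t₀ hr₀) fun t ht => hgood t ht)

end Summit.CriticalPhenomena.CardyFormulaZ2.Theorems
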